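import Summits.KontsevichZagierPeriods.KontsevichZagierPeriods.Theorems.HurwitzMicroSectorsNormalFormPrincipleM2CycloReduce

/-!
# `NormalFormPrinciple` (stmt-KontsevichZagierPeriods-3869), line `SketchIdeator1` — leaf `stub_boxRigidity`:
# the CYCLOTOMIC LOG LAYER, II: Conjecture 1 on the subgroup (kernel form) and corollaries

Second file of the composition (lead seat c8): the reduction `cycloMonomial_reduce` of file I
(`…M2CycloReduce.lean`) combined with seat c7's level-one kernel theorem. The layer generalising P3
(`FiveZetaTwoOffProduct`): the unfolded log monomials
`M(c/x, F/F') = [{0 < x < 1, 1 ≤ s ≤ F(x)/F'(x)}, (c/x)/s]` (`c ∈ ℚ`; value `∫₀¹ (c/x) log(F/F') dx`)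
whose edges are quotients `F/F'` (`F' ≤ F` on `(0,1)`) of finite products
`F(n,a,b)(x) = ∏_{d<n} G_{d+1}(x)^{a d} · H_{d+1}(x)^{b d}` of the cyclotomic-type factors
`G_{d+1} = 1 + x + ⋯ + x^d` and `H_{d+1} = 1/(1 − x^{d+1})` — Mahler-measure-type logarithmic periods with
values in `ℚ·ζ(2)` (`∫₀¹ (c/x) log G_{d+1} = cζ(2)(1 − 1/(d+1))`, `∫₀¹ (c/x) log H_{d+1} = cζ(2)/(d+1)`).

* `cycloMonomial_prod_reduce` / `cycloMonomial_reduce`: by rules (1a), (1b), (2) only — product rule on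
  unfolded monomials (peeling one factor at a time, `cyclo_peel`), base dilations `u = x^{d+1}` and the
  ζ(2) block with rational weight (`cyclo_base`, `logMonomial_dilate`, `logMonomialInv_sub_zetaBand_rat`) —
  every such monomial is congruent to ONE level-one box `[(0,1)², cρ/(1 − xy)]`, `ρ ∈ ℚ` explicit;
* `cyclo_mem_relations_of_eval_eq_zero_of_mem_closure`: **Conjecture 1 of Kontsevich–Zagier, kernel form,
  on the subgroup generated by all cyclotomic log monomials, the level-one boxes `[(0,1)², P/(1−xy)]` and
  the polynomial boxes `[(0,1)ᵐ, p]`**, unconditionally (reduction to c7's normal form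
  `[(0,1)², β/(1−xy)] + [pt, q]`; rigidity `π² ∉ ℚ`);
* two-representation corollaries (monomial vs monomial, vs level-one box, vs polynomial box / rational point).
References: M. Kontsevich, D. Zagier, *Periods* (2001), §1.1 (logarithmic integrands, Mahler measures),
§1.2 (rules (1), (2), Conjecture 1). No definitions are introduced.
-/

noncomputable section

open MeasureTheory Set
open Literature.NumberTheory.Transcendental Literature.NumberTheory.Transcendental.KZ
open Literature.ModelTheory.ExponentialFields (IsSemialgebraic)

namespace Summit.KontsevichZagierPeriods.HurwitzMicroSectors.NormalFormPrinciple.PiBox.M2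

open Summit.KontsevichZagierPeriods.HurwitzMicroSectors.NormalFormPrinciple.PiBox.LevelOne
  (exists_zetaTwoRep mem_relations_of_eval_eq_zero_of_mem_closure)

/-! ## The layer: Conjecture 1, kernel form, on the subgroup generated by the cyclotomic log
monomials, the level-one boxes and the polynomial boxes -/

/-- **Every element of the enlarged subgroup differs by relations from an element of c7's subgroup**
(generated by the level-one boxes and the polynomial boxes). [cite: KontsevichZagier2001, §1.2] -/
theorem exists_mem_levelOneClosure_of_mem_cycloClosure {x : FormalRep}
    (hx : x ∈ AddSubgroup.closure
      ({y : FormalRep | ∃ (c : ℚ) (n : ℕ) (a b a' b' : ℕ → ℕ) (R : IntegralRep 2),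
          (∀ t ∈ Set.Ioo (0:ℝ) 1,
            ∏ d ∈ Finset.range n, (∑ i ∈ Finset.range (d + 1), t ^ i) ^ (a' d) *
              (1 / (1 - t ^ (d + 1))) ^ (b' d) ≤
            ∏ d ∈ Finset.range n, (∑ i ∈ Finset.range (d + 1), t ^ i) ^ (a d) *
              (1 / (1 - t ^ (d + 1))) ^ (b d)) ∧
          R.domain = KZlog.band {y : Fin 1 → ℝ | 0 < y 0 ∧ y 0 < 1} (fun _ => (1:ℝ))
            (fun y => (∏ d ∈ Finset.range n,
              (∑ i ∈ Finset.range (d + 1), y 0 ^ i) ^ (a d) * (1 / (1 - y 0 ^ (d + 1))) ^ (b d)) /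
              (∏ d ∈ Finset.range n,
              (∑ i ∈ Finset.range (d + 1), y 0 ^ i) ^ (a' d) * (1 / (1 - y 0 ^ (d + 1))) ^ (b' d))) ∧
          EqOn R.integrand (fun z => ((c : ℝ) / z 0) / z 1) R.domain ∧ y = of R} ∪
       ({y : FormalRep | ∃ (P : MvPolynomial (Fin 2) ℚ) (N : IntegralRep 2),
          N.domain = {x | ∀ i, x i ∈ Set.Ioo (0:ℝ) 1} ∧
          EqOn N.integrand (fun x => (MvPolynomial.aeval x P : ℝ) / (1 - x 0 * x 1)) N.domain ∧
          y = of N} ∪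
       {y : FormalRep | ∃ (m : ℕ) (p : MvPolynomial (Fin m) ℚ) (N : IntegralRep m),
          N.domain = {x | ∀ i, x i ∈ Set.Ioo (0:ℝ) 1} ∧
          EqOn N.integrand (fun x => (MvPolynomial.aeval x p : ℝ)) N.domain ∧ y = of N}))) :
    ∃ x' ∈ AddSubgroup.closure
      ({y : FormalRep | ∃ (P : MvPolynomial (Fin 2) ℚ) (N : IntegralRep 2),
          N.domain = {x | ∀ i, x i ∈ Set.Ioo (0:ℝ) 1} ∧
          EqOn N.integrand (fun x => (MvPolynomial.aeval x P : ℝ) / (1 - x 0 * x 1)) N.domain ∧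
          y = of N} ∪
       {y : FormalRep | ∃ (m : ℕ) (p : MvPolynomial (Fin m) ℚ) (N : IntegralRep m),
          N.domain = {x | ∀ i, x i ∈ Set.Ioo (0:ℝ) 1} ∧
          EqOn N.integrand (fun x => (MvPolynomial.aeval x p : ℝ)) N.domain ∧ y = of N}),
      x - x' ∈ relations := by
  induction hx using AddSubgroup.closure_induction with
  | mem y hy =>
    rcases hy with hy | hy
    · obtain ⟨c, n, a, b, a', b', R, hle, hRd, hRi, rfl⟩ := hy
      obtain ⟨B, hBd, hBi⟩ := exists_zetaTwoRep (c * (∑ d ∈ Finset.range n,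
        ((a d : ℚ) * (1 - 1 / (d + 1)) + (b d : ℚ) / (d + 1)) - ∑ d ∈ Finset.range n,
        ((a' d : ℚ) * (1 - 1 / (d + 1)) + (b' d : ℚ) / (d + 1))))
      refine ⟨of B, AddSubgroup.subset_closure (Or.inl ⟨MvPolynomial.C (c * (∑ d ∈ Finset.range n,
        ((a d : ℚ) * (1 - 1 / (d + 1)) + (b d : ℚ) / (d + 1)) - ∑ d ∈ Finset.range n,
        ((a' d : ℚ) * (1 - 1 / (d + 1)) + (b' d : ℚ) / (d + 1)))), B, hBd, fun x hx => ?_, rfl⟩),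
        cycloMonomial_reduce c n a b a' b' hle R B hRd hRi hBd hBi⟩
      rw [hBi hx]
      simp
    · exact ⟨y, AddSubgroup.subset_closure hy, by simp [relations.zero_mem]⟩
  | zero => exact ⟨0, AddSubgroup.zero_mem _, by simp [relations.zero_mem]⟩
  | add y z _ _ ihy ihz =>
    obtain ⟨y', hy', ey⟩ := ihy
    obtain ⟨z', hz', ez⟩ := ihz
    refine ⟨y' + z', AddSubgroup.add_mem _ hy' hz', ?_⟩
    have e : y + z - (y' + z') = (y - y') + (z - z') := by abel
    rw [e]
    exact relations.add_mem ey ez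
  | neg y _ ihy =>
    obtain ⟨y', hy', ey⟩ := ihy
    refine ⟨-y', AddSubgroup.neg_mem _ hy', ?_⟩
    have e : -y - -y' = -(y - y') := by abel
    rw [e]
    exact relations.neg_mem ey

/-- **Conjecture 1 of Kontsevich–Zagier, kernel form, on the subgroup generated by the CYCLOTOMIC LOG
MONOMIALS `M(c/x, F/F')` (`c ∈ ℚ`; `F, F'` finite products of `1 + x + ⋯ + x^d` and `1/(1 − x^{d+1})`,
`F' ≤ F`; Mahler-measure-type log periods `∫₀¹ (c/x) log(F/F') dx ∈ ℚ·ζ(2)`), the level-one boxes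
`[(0,1)², P/(1 − xy)]` and the polynomial boxes `[(0,1)ᵐ, p]`** — UNCONDITIONALLY: a formal
`ℤ`-combination with value `0` is a relation. Reduction by rules (1a), (1b), (2) to c7's level-one
normal form; rigidity is `π² ∉ ℚ` (Lindemann). [cite: KontsevichZagier2001, §1.2 Conjecture 1] -/
theorem cyclo_mem_relations_of_eval_eq_zero_of_mem_closure {x : FormalRep}
    (hx : x ∈ AddSubgroup.closure
      ({y : FormalRep | ∃ (c : ℚ) (n : ℕ) (a b a' b' : ℕ → ℕ) (R : IntegralRep 2),
          (∀ t ∈ Set.Ioo (0:ℝ) 1,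
            ∏ d ∈ Finset.range n, (∑ i ∈ Finset.range (d + 1), t ^ i) ^ (a' d) *
              (1 / (1 - t ^ (d + 1))) ^ (b' d) ≤
            ∏ d ∈ Finset.range n, (∑ i ∈ Finset.range (d + 1), t ^ i) ^ (a d) *
              (1 / (1 - t ^ (d + 1))) ^ (b d)) ∧
          R.domain = KZlog.band {y : Fin 1 → ℝ | 0 < y 0 ∧ y 0 < 1} (fun _ => (1:ℝ))
            (fun y => (∏ d ∈ Finset.range n,
              (∑ i ∈ Finset.range (d + 1), y 0 ^ i) ^ (a d) * (1 / (1 - y 0 ^ (d + 1))) ^ (b d)) /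
              (∏ d ∈ Finset.range n,
              (∑ i ∈ Finset.range (d + 1), y 0 ^ i) ^ (a' d) * (1 / (1 - y 0 ^ (d + 1))) ^ (b' d))) ∧
          EqOn R.integrand (fun z => ((c : ℝ) / z 0) / z 1) R.domain ∧ y = of R} ∪
       ({y : FormalRep | ∃ (P : MvPolynomial (Fin 2) ℚ) (N : IntegralRep 2),
          N.domain = {x | ∀ i, x i ∈ Set.Ioo (0:ℝ) 1} ∧
          EqOn N.integrand (fun x => (MvPolynomial.aeval x P : ℝ) / (1 - x 0 * x 1)) N.domain ∧
          y = of N} ∪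
       {y : FormalRep | ∃ (m : ℕ) (p : MvPolynomial (Fin m) ℚ) (N : IntegralRep m),
          N.domain = {x | ∀ i, x i ∈ Set.Ioo (0:ℝ) 1} ∧
          EqOn N.integrand (fun x => (MvPolynomial.aeval x p : ℝ)) N.domain ∧ y = of N})))
    (hv : eval x = 0) : x ∈ relations := by
  obtain ⟨x', hx', e⟩ := exists_mem_levelOneClosure_of_mem_cycloClosure hx
  have h0 : eval x' = 0 := by
    have h := relations_le_ker_eval_holds e
    rw [AddMonoidHom.mem_ker, map_sub, hv, zero_sub, neg_eq_zero] at h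
    exact h
  have hx'r := mem_relations_of_eval_eq_zero_of_mem_closure hx' h0
  have e' : x = (x - x') + x' := by abel
  rw [e']
  exact relations.add_mem e hx'r

/-- **Conjecture 1 for pairs of cyclotomic log monomials** (two-representation form): two such
representations with equal values are KZ-equivalent — e.g. `3·∫₀¹ log(1+x+x²)/x = 2·∫₀¹ log(1/(1−x))/x`,
`4·∫₀¹ log(1+x²)/x = ∫₀¹ log(1/(1−x))/x` inside the calculus. [cite: KontsevichZagier2001, §1.2 Conjecture 1] -/
theorem cycloMonomial_equivalent_of_value_eq (c c' : ℚ) (n n' : ℕ) (a b a₁ b₁ : ℕ → ℕ)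
    (a' b' a₁' b₁' : ℕ → ℕ)
    (hle : ∀ t ∈ Set.Ioo (0:ℝ) 1,
      ∏ d ∈ Finset.range n, (∑ i ∈ Finset.range (d + 1), t ^ i) ^ (a₁ d) * (1 / (1 - t ^ (d + 1))) ^ (b₁ d) ≤
      ∏ d ∈ Finset.range n, (∑ i ∈ Finset.range (d + 1), t ^ i) ^ (a d) * (1 / (1 - t ^ (d + 1))) ^ (b d))
    (hle' : ∀ t ∈ Set.Ioo (0:ℝ) 1,
      ∏ d ∈ Finset.range n', (∑ i ∈ Finset.range (d + 1), t ^ i) ^ (a₁' d) * (1 / (1 - t ^ (d + 1))) ^ (b₁' d) ≤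
      ∏ d ∈ Finset.range n', (∑ i ∈ Finset.range (d + 1), t ^ i) ^ (a' d) * (1 / (1 - t ^ (d + 1))) ^ (b' d))
    (R R' : IntegralRep 2)
    (hRd : R.domain = KZlog.band {y : Fin 1 → ℝ | 0 < y 0 ∧ y 0 < 1} (fun _ => (1:ℝ))
      (fun y => (∏ d ∈ Finset.range n,
        (∑ i ∈ Finset.range (d + 1), y 0 ^ i) ^ (a d) * (1 / (1 - y 0 ^ (d + 1))) ^ (b d)) /
        (∏ d ∈ Finset.range n,
        (∑ i ∈ Finset.range (d + 1), y 0 ^ i) ^ (a₁ d) * (1 / (1 - y 0 ^ (d + 1))) ^ (b₁ d))))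
    (hRi : EqOn R.integrand (fun z => ((c : ℝ) / z 0) / z 1) R.domain)
    (hR'd : R'.domain = KZlog.band {y : Fin 1 → ℝ | 0 < y 0 ∧ y 0 < 1} (fun _ => (1:ℝ))
      (fun y => (∏ d ∈ Finset.range n',
        (∑ i ∈ Finset.range (d + 1), y 0 ^ i) ^ (a' d) * (1 / (1 - y 0 ^ (d + 1))) ^ (b' d)) /
        (∏ d ∈ Finset.range n',
        (∑ i ∈ Finset.range (d + 1), y 0 ^ i) ^ (a₁' d) * (1 / (1 - y 0 ^ (d + 1))) ^ (b₁' d))))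
    (hR'i : EqOn R'.integrand (fun z => ((c' : ℝ) / z 0) / z 1) R'.domain)
    (hv : R.value = R'.value) : Equivalent R R' := by
  refine cyclo_mem_relations_of_eval_eq_zero_of_mem_closure (AddSubgroup.sub_mem _
    (AddSubgroup.subset_closure (Or.inl ⟨c, n, a, b, a₁, b₁, R, hle, hRd, hRi, rfl⟩))
    (AddSubgroup.subset_closure (Or.inl ⟨c', n', a', b', a₁', b₁', R', hle', hR'd, hR'i, rfl⟩))) ?_
  rw [map_sub, eval_of, eval_of, hv, sub_self]

/-- **Mixed pairs: a cyclotomic log monomial against a level-one box** `[(0,1)², P/(1 − xy)]`: equal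
values imply KZ-equivalence (e.g. `∫₀¹ log(1/(1−x))/x dx = ∫∫ dxdy/(1−xy)` inside the calculus).
[cite: KontsevichZagier2001, §1.2 Conjecture 1] -/
theorem cycloMonomial_equivalent_levelOne_of_value_eq (c : ℚ) (n : ℕ) (a b a₁ b₁ : ℕ → ℕ)
    (hle : ∀ t ∈ Set.Ioo (0:ℝ) 1,
      ∏ d ∈ Finset.range n, (∑ i ∈ Finset.range (d + 1), t ^ i) ^ (a₁ d) * (1 / (1 - t ^ (d + 1))) ^ (b₁ d) ≤
      ∏ d ∈ Finset.range n, (∑ i ∈ Finset.range (d + 1), t ^ i) ^ (a d) * (1 / (1 - t ^ (d + 1))) ^ (b d))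
    (R N : IntegralRep 2) (P : MvPolynomial (Fin 2) ℚ)
    (hRd : R.domain = KZlog.band {y : Fin 1 → ℝ | 0 < y 0 ∧ y 0 < 1} (fun _ => (1:ℝ))
      (fun y => (∏ d ∈ Finset.range n,
        (∑ i ∈ Finset.range (d + 1), y 0 ^ i) ^ (a d) * (1 / (1 - y 0 ^ (d + 1))) ^ (b d)) /
        (∏ d ∈ Finset.range n,
        (∑ i ∈ Finset.range (d + 1), y 0 ^ i) ^ (a₁ d) * (1 / (1 - y 0 ^ (d + 1))) ^ (b₁ d))))
    (hRi : EqOn R.integrand (fun z => ((c : ℝ) / z 0) / z 1) R.domain)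
    (hNd : N.domain = {x | ∀ i, x i ∈ Set.Ioo (0:ℝ) 1})
    (hNi : EqOn N.integrand (fun x => (MvPolynomial.aeval x P : ℝ) / (1 - x 0 * x 1)) N.domain)
    (hv : R.value = N.value) : Equivalent R N := by
  refine cyclo_mem_relations_of_eval_eq_zero_of_mem_closure (AddSubgroup.sub_mem _
    (AddSubgroup.subset_closure (Or.inl ⟨c, n, a, b, a₁, b₁, R, hle, hRd, hRi, rfl⟩))
    (AddSubgroup.subset_closure (Or.inr (Or.inl ⟨P, N, hNd, hNi, rfl⟩)))) ?_
  rw [map_sub, eval_of, eval_of, hv, sub_self]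

/-- **Mixed pairs: a cyclotomic log monomial against a polynomial box of any dimension** (in particular
against a rational point, `m = 0`): equal values imply KZ-equivalence; with a point, `π² ∉ ℚ` forces the
log period to vanish. [cite: KontsevichZagier2001, §1.2 Conjecture 1] -/
theorem cycloMonomial_equivalent_boxPoly_of_value_eq {m : ℕ} (c : ℚ) (n : ℕ) (a b a₁ b₁ : ℕ → ℕ)
    (hle : ∀ t ∈ Set.Ioo (0:ℝ) 1,
      ∏ d ∈ Finset.range n, (∑ i ∈ Finset.range (d + 1), t ^ i) ^ (a₁ d) * (1 / (1 - t ^ (d + 1))) ^ (b₁ d) ≤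
      ∏ d ∈ Finset.range n, (∑ i ∈ Finset.range (d + 1), t ^ i) ^ (a d) * (1 / (1 - t ^ (d + 1))) ^ (b d))
    (R : IntegralRep 2) (N : IntegralRep m) (p : MvPolynomial (Fin m) ℚ)
    (hRd : R.domain = KZlog.band {y : Fin 1 → ℝ | 0 < y 0 ∧ y 0 < 1} (fun _ => (1:ℝ))
      (fun y => (∏ d ∈ Finset.range n,
        (∑ i ∈ Finset.range (d + 1), y 0 ^ i) ^ (a d) * (1 / (1 - y 0 ^ (d + 1))) ^ (b d)) /
        (∏ d ∈ Finset.range n,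
        (∑ i ∈ Finset.range (d + 1), y 0 ^ i) ^ (a₁ d) * (1 / (1 - y 0 ^ (d + 1))) ^ (b₁ d))))
    (hRi : EqOn R.integrand (fun z => ((c : ℝ) / z 0) / z 1) R.domain)
    (hNd : N.domain = {x | ∀ i, x i ∈ Set.Ioo (0:ℝ) 1})
    (hNi : EqOn N.integrand (fun x => (MvPolynomial.aeval x p : ℝ)) N.domain)
    (hv : R.value = N.value) : Equivalent R N := by
  refine cyclo_mem_relations_of_eval_eq_zero_of_mem_closure (AddSubgroup.sub_mem _
    (AddSubgroup.subset_closure (Or.inl ⟨c, n, a, b, a₁, b₁, R, hle, hRd, hRi, rfl⟩))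
    (AddSubgroup.subset_closure (Or.inr (Or.inr ⟨m, p, N, hNd, hNi, rfl⟩)))) ?_
  rw [map_sub, eval_of, eval_of, hv, sub_self]

end Summit.KontsevichZagierPeriods.HurwitzMicroSectors.NormalFormPrinciple.PiBox.M2
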